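import Summits.ABC.IUTFork.Cor312UnitCosetCoarseThm311
import HarnessLib

/-!
# [IUTchIII] Cor. 3.12 — the COSET test model, VI-a: the GRADED-SHELL coarse-frame coset bed — situation and typed Theorem 3.11

Record-only file (D-0012; MODEL DATA `ksData`/`ksLine`/`ksSituation`/`ksFull`, then proofs; no `Prop` fact, nothing asserted about print) of
the abc-iut cell (wave-4 prover abc-iut-w4-d101, gen 6 — author lineage of the countermodel of record `PinnedWitness.pinned_countermodel`
p419720, of the U/COSET models and of the coarse-frame coset bed «K» `UnitCosetCoarse.kSetting` p439797/p441039/p441461). TAKES NO SIDE on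
[IUTchIII] Cor. 3.12. Answers abc-iut-rp-cx XREAD-8 §4 BED REQUEST «K-fat» (2026-08-26T11:50:02Z; MODEL-SPACE LIMIT #5: «a bed carrying BOTH
the Statement and a log-shell container fatter than the frame's») on the COSET carrier, i.e. on the MOVING-orbit bed the limit asks for.

Bed K (`Cor312UnitCosetCoarseThm311`: coset Θ-pilot Kummer images `±q^{j²}(1+p𝒪)` MOVED by the unit (Ind2)-families, valuation-ball
log-volume `bvol` ⇒ `j²` EXACT, KummerB, Step (x)) with ONE field made a parameter: the mono-analytic integral structures (i)(a)
`MRData.shellPk`/`shellSub` of the line data are the GRADED log-shell **`𝓘_j := p^{−δ_j}·𝒪 = B_{−δ_j}`** for an arbitrary depth function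
`δ : 𝔽_l → ℕ` (K is `δ ≡ 0`; abc-iut-rp-d2's FAT model `CandInternal2Fat` is the label-constant case on the sign carrier). Source of the
field: [IUTchIII] `paper:url-4b091feeb646` Thm. 3.11 (i) (a) pp. 153–154 «the … mono-analytic integral structures 𝓘(^{S^±_{j+1}};^{n,∘}𝒟⊢_{v_ℚ})
⊆ 𝓘^ℚ(…)», one per label `j`; (ii) (Ind3) p. 156 l. 33–40 «natural inclusions ⊆» (upper bounds only). The typed [IUTchIII] Theorem 3.11
(i)–(iii) HOLDS for every `δ` (`ksFull_statement`: the only clause reading the shell is (Ind3) `unitImage ⊆ shellPk`, i.e. `B_{m'+1} ⊆ B_{−δ_j}`);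
the columns ARE bed K's `UnitCosetCoarse.kColumn` BY NAME (`kColumn_kummerB_ksLine`); admissibility, volume, splitting monoids, action are
K's by `rfl` (`ksLine_adm_eq`, `ksLine_logvol_eq`, `ksLine_Psi`, `ksLine_act`), so Step (x) holds verbatim (`ksLine_hAdm`, `ksLine_logvolInvariant`).
Sequels: `Cor312UnitCosetShell` (the setting `ksSetting`: pins, BridgeHyps, hull `q𝒪`, Licence, Statement with equality, ¬S ∀ q-pinned q-data
— none reads the shell) and `Cor312UnitCosetShellCells` (the log-shell container `⋃_m ρ(frobΨ m·𝓘)_j = B_{j²−δ_j}` EXACTLY; RP-I05 ⟺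
`δ_j ≤ j²−1`, RP-I05c ⟺ RP-I06⋆ ⟺ `j²−1 ≤ δ_j` on `𝔽_l^⋇`; instances `δ ≡ 3` and `δ⋆_j = j²−1`). One place (`toyIndex`, `l⋇ = 2`); a model of the
typed interface, not of initial Θ-data; no judgement on print. [claim: Mochizuki2012, status: disputed] [cite: ScholzeStix2018, §2.2 pp. 9–10]
-/

noncomputable section

namespace Summit.ABC.IUTFork.Cor312Vol.UnitCosetShell

open Set Thm311 Cor312 Cor312.Checks Cor312.IdentifiedNonVacuity NaiveWitness UnitWitness UnitCoset UnitCosetCoarse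
  Literature.IUT.LogThetaLattice

variable (p : ℕ) [hp : Fact p.Prime] (δ : toyIndex.Label → ℕ)

/-! ## 1. Line data with a GRADED typed log-shell `𝓘_j = B_{−δ_j}` -/

omit hp in
/-- **The data (a)(b)(c) of line `0` with the GRADED log-shell**: bed K's `UnitCosetCoarse.kData` with the integral structures (i)(a)
`shellPk`/`shellSub := B_{−δ_j} = p^{−δ_j}·𝒪` at label `j` (admissible regions, log-volume `bvol`, splitting monoid, action, number field
unchanged). MODEL DATA. [claim: Mochizuki2012, status: disputed] -/
def ksData : MRData (unitShells p) :=
  { kData p with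
    shellPk := fun j vQ => uBall p j vQ (-(δ j : ℤ))
    shellSub := fun j v => uBall p j (toyIndex.over v) (-(δ j : ℤ)) }

/-- **Line `n`**: the transport of the line-`0` data by the unit `u₀^n` (bed K's `lineFam`). MODEL DATA. [claim: Mochizuki2012, status: disputed] -/
def ksLine (n : ℤ) : MRData (unitShells p) := (ksData p δ).map (lineFam p n)

/-- The admissibility predicate of every line IS bed K's. [folklore] -/
theorem ksLine_adm_eq (n : ℤ) : (ksLine p δ n).Adm = (kLine p n).Adm := rfl

/-- The log-volume of every line IS bed K's. [folklore] -/
theorem ksLine_logvol_eq (n : ℤ) : (ksLine p δ n).logvol = (kLine p n).logvol := rfl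

/-- The splitting monoid of line `n` IS bed K's (hence part I's). [folklore] -/
theorem ksLine_Psi (n : ℤ) : (ksLine p δ n).Ψ = (kLine p n).Ψ := rfl

/-- The [multiplicative] action (i)(b) of line `n` IS bed K's. [folklore] -/
theorem ksLine_act (n : ℤ) : (ksLine p δ n).act = (kLine p n).act := rfl

/-- The number-field copy of line `n` IS bed K's. [folklore] -/
theorem ksLine_Mmod_eq (n : ℤ) : (ksLine p δ n).Mmod = (kLine p n).Mmod := rfl

/-- The admissible regions of every line are the balls and the pairs. [folklore] -/
theorem ksLine_adm_iff (n : ℤ) (j : toyIndex.Label) (vQ : toyIndex.VQ) (A : Set ((unitShells p).Packet j vQ)) :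
    (ksLine p δ n).Adm j vQ A ↔ Adm' p j vQ A := by
  rw [ksLine_adm_eq]; exact kLine_adm_iff p n j vQ A

/-- The log-volume of every line is `bvol`. [folklore] -/
theorem ksLine_logvol (n : ℤ) (j : toyIndex.Label) (vQ : toyIndex.VQ) (A : Set ((unitShells p).Packet j vQ)) :
    (ksLine p δ n).logvol j vQ A = bvol p j vQ A := by
  rw [ksLine_logvol_eq]; exact kLine_logvol p n j vQ A

/-- **The integral structure of line `n` at label `j` is the graded shell `B_{−δ_j}`** (units fix balls). [folklore] -/
theorem ksLine_shellPk (n : ℤ) (j : toyIndex.Label) (vQ : toyIndex.VQ) : (ksLine p δ n).shellPk j vQ = uBall p j vQ (-(δ j : ℤ)) :=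
  image_uBall_of_actsByUnits (lineFam_actsByUnits p n) j vQ _

/-- The number-field copy of line `n` is everything. [folklore] -/
theorem ksLine_Mmod (n : ℤ) (j : toyIndex.LabelStar) : (ksLine p δ n).Mmod j = Set.univ := by
  rw [ksLine_Mmod_eq]; exact kLine_Mmod p n j

/-- **Step (x) invariance, admissibility half** (bed K's, verbatim). [folklore] -/
theorem ksLine_hAdm (n : ℤ) : ∀ Φ ∈ (unitShells p).Ind1Family ∪ (unitShells p).Ind2Family,
    ∀ (j : toyIndex.Label) (vQ : toyIndex.VQ) (B : Set ((unitShells p).Packet j vQ)),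
      (ksLine p δ n).Adm j vQ B ↔ (ksLine p δ n).Adm j vQ (Φ j vQ '' B) := by
  rw [ksLine_adm_eq]; exact kLine_hAdm p n

/-- **Step (x) invariance, volume half**: `LogvolInvariant` for every line (bed K's, verbatim). [folklore] -/
theorem ksLine_logvolInvariant (n : ℤ) : (ksLine p δ n).LogvolInvariant := by
  intro Φ hΦ j vQ A _
  rw [ksLine_logvol, ksLine_logvol]
  exact bvol_image p (actsByUnits_of_mem_closure (Subgroup.subset_closure (show Φ ∈ _ ∪ _ from hΦ))) j vQ A

/-! ## 2. Situation, columns (bed K's), full situation; the typed Theorem 3.11 -/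

/-- **The GRADED-SHELL COSET SITUATION** (global degrees as in part I / bed K). MODEL DATA (an `abbrev`). [claim: Mochizuki2012, status: disputed] -/
abbrev ksSituation : Situation toyIndex where
  L := unitShells p
  D := ksLine p δ
  G := fun _ j => cDegrees p j

/-- **The full situation of the graded-shell coset bed**: the columns are bed K's `UnitCosetCoarse.kColumn` (same Kummer images, unit images,
sign twist), the link data abc-iut-w5-d247's `naiveLink`. MODEL DATA (an `abbrev`). [claim: Mochizuki2012, status: disputed] -/
abbrev ksFull : FullSituation toyIndex where
  toSituation := ksSituation p δ
  col := kColumn p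
  link := naiveLink

/-- The Kummer images of the columns ARE bed K's / part I's. [folklore] -/
theorem ksFull_frobΨ (n m : ℤ) : ((ksFull p δ).col n).frobΨ m = (kColumn p n).frobΨ m := rfl

/-- **Thm. 3.11 (i) `MultiradialCompat`** through genuine (Ind2)-moves (line `n` is one move away from line `0`'s data). [folklore] -/
theorem ks_multiradialCompat : (ksFull p δ).MultiradialCompat := fun n n' =>
  (MRData.RLGP_eq_iff _ _).2
    (Relation.EqvGen.trans _ _ _
      (Relation.EqvGen.symm _ _ (Relation.EqvGen.rel _ _ ⟨lineFam p n, Or.inr (lineFam_mem_Ind2Family p n), rfl⟩))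
      (Relation.EqvGen.rel _ _ ⟨lineFam p n', Or.inr (lineFam_mem_Ind2Family p n'), rfl⟩))

/-- (i): sub-packets, degree clause on the balls, multiradial compatibility. [folklore] -/
theorem ks_partI : (ksFull p δ).PartI := by
  refine ⟨fun n v hv x _ j => ?_, fun n j k => ⟨fun vQ => (ksLine_adm_iff p δ n _ vQ _).2 (Or.inl ⟨k, rfl⟩), Set.toFinite _, ?_⟩,
    ks_multiradialCompat p δ⟩
  · show x j ∈ signShells.SubPacket j.1 v
    rw [subPacket_eq_top]; trivial
  · rw [finsum_unique]
    exact ((ksLine_logvol p δ n j.1 _ _).trans (bvol_uBall p j.1 _ k)).symm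

/-- **(ii) (b) KummerB** of bed K's column over the graded-shell line (same splitting monoids). [folklore] -/
theorem kColumn_kummerB_ksLine (n : ℤ) : (kColumn p n).KummerB (ksLine p δ n) := by
  intro m v hv
  show (unitShells p).starAut (twist m) v '' ((unitShells p).starAut (lineFam p n) v '' Psi p v) =
    (unitShells p).starAut (lineFam p n) v '' Psi p v
  rw [(twist_actsByUnits p m).image_starAut_comm (lineFam_actsByUnits p n)]
  exact congrArg _ (image_Psi_of_actsBySigns p (twist_actsBySigns m) v)

/-- (ii): KummerA by unit-invariance of class and volume; KummerB; KummerC; **(Ind3): the unit-group images `B_{m'+1}` lie in the graded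
shell `B_{−δ_j}`** a fortiori (`−δ_j ≤ 0 ≤ m'+1`). [folklore] -/
theorem ks_partII : (ksFull p δ).toLatticeSituation.PartII := by
  intro n
  refine (Column.partII_iff _ _).2 ⟨fun m j vQ A hA => ⟨?_, ?_⟩, kColumn_kummerB_ksLine p δ n, fun m j => ?_, ?_⟩
  · exact (adm'_image_iff p (twist_actsByUnits p m) j vQ A).2 ((ksLine_adm_iff p δ n j vQ A).1 hA)
  · exact (bvol_image p (twist_actsByUnits p m) j vQ A).trans (ksLine_logvol p δ n j vQ A).symm
  · show (unitShells p).globalAut (twist m) j.1 '' (kLine p n).Mmod j = (ksLine p δ n).Mmod j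
    exact (congrArg _ (kLine_Mmod p n j)).trans
      ((Set.image_univ_of_surjective ((unitShells p).globalAut (twist m) j.1).surjective).trans (ksLine_Mmod p δ n j).symm)
  · refine ⟨fun m m' j vQ _ => ?_, fun m j vQ h => absurd trivial h⟩
    exact (uBall_mono p j vQ (show (-(δ j : ℤ)) ≤ (m' : ℤ) + 1 by omega)).trans (ksLine_shellPk p δ n j vQ).symm.subset

/-- (iii): as for bed K (same link data). [folklore] -/
theorem ks_partIII : (ksFull p δ).PartIII := by
  refine ⟨naiveLink.partIIIa_holds, naiveLink.partIIIb_holds, ?_, ?_,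
    (ksFull p δ).evalCompatUpToInd_of_multiradialCompat (ks_multiradialCompat p δ)⟩
  · refine naiveLink.partIIIc_of_full (fun _ => rfl) fun n m => ?_
    rintro _ ⟨a, rfl⟩
    show unitIso a ≪≫ unitIso ((-1) ^ m.natAbs) = unitIso ((-1) ^ m.natAbs) ≪≫ unitIso a
    rw [unitIso_trans, unitIso_trans, mul_comm]
  · intro n m; exact Thm311.PolyIsoCalc.stabilized_full _ _

/-- **The typed [IUTchIII] Theorem 3.11 (i) ∧ (ii) ∧ (iii) HOLDS in the graded-shell coset bed, for EVERY depth function `δ`.** [folklore] -/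
theorem ksFull_statement : (ksFull p δ).Statement := ⟨ks_partI p δ, ks_partII p δ, ks_partIII p δ⟩

end Summit.ABC.IUTFork.Cor312Vol.UnitCosetShell

end
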